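import Mathlib
import Summits.NavierStokesRegularity.NavierStokesRegularity.Theorems.EulerZoomLiouvillePowerGaugeEulerLiouvilleGalileanFrameShear
import HarnessLib

/-!
# Crux E `PowerGaugeEulerLiouville` (stmt-NavierStokesRegularity-19832), line `galilean-frames` (ns-idea-11 g6/g7), stub F3
# `stub_wanderingReduce` — tools II: PAIRINGS IN A WANDERING SIMILARITY FRAME ARE `C¹` / CONTINUOUS IN TIME (width seat ns-ezl-w3 g5)

Route №10 `EulerZoomLiouville` (NavierStokesRegularity), crux E.  A WANDERING self-similar member of the line `galilean-frames` reads
`u(τ, y) = (T−τ)^{γ−1} V((T−τ)^{−γ}(y − ξ(τ)))`; in the similarity frame `y = ξ(τ) + (T−τ)^γ Y` its pairings with a fixed test field become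
`∫ ⟪V(Y), Φ(ξ(τ) + (T−τ)^γ Y)⟫ dY`.  For `V ∈ L¹_loc` (resp. `|V|² ∈ L¹_loc`), `Φ` a test field, `Ψ` a continuous compactly supported operator
field, `ξ ∈ C¹`, `0 < γ ≤ 1` and times `τ < T`:

* `hasDerivAt_wanderingPairing` — `τ ↦ ∫ ⟪V, Φ(ξ(τ) + (T−τ)^γ ·)⟫` has derivative `∫ ⟪V(Y), DΦ(…)(ξ'(τ) − γ(T−τ)^{γ−1} Y)⟫ dY`
  (dominated differentiation under the integral sign);
* `continuousOn_wanderingPairing_clm` — `τ ↦ ∫ ⟪V(Y), Ψ(ξ(τ) + (T−τ)^γ Y)(c(τ) + d(τ) Y)⟫ dY` is continuous on `(−∞, T)` (`c, d` continuous);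
* `continuousOn_wanderingPairing_clm_self` — `τ ↦ ∫ ⟪V(Y), Ψ(ξ(τ) + (T−τ)^γ Y) V(Y)⟫ dY` is continuous on `(−∞, T)`.

WHAT THIS IS NOT: not NS regularity, not the crux E — tools for one stratum of the crux CLASS 19832 (MODEL lattice; E/NS strata),
`--supports` stmt-19832; 19832 OPEN. [folklore]
-/

noncomputable section

-- flat `Theorems/<Route><Decl>…` files of one crux share the namespace of the crux (tree convention: `Summit.<S>.<S>.…`)
set_option linter.dupNamespace false

open MeasureTheory Set Filter Topology Metric Function TopologicalSpace InnerProductSpace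
open scoped ENNReal NNReal RealInnerProductSpace ContDiff

namespace Summit.NavierStokesRegularity.NavierStokesRegularity.Theorems.PowerGaugeEulerLiouville

namespace GalileanFrames

open Literature.Analysis Literature.Analysis.FunctionSpaces Literature.Analysis.FluidPDE
open Summit.NavierStokesRegularity.NavierStokesRegularity.Theorems.PowerGaugeEulerLiouville

variable {V : EuclideanSpace ℝ (Fin 3) → EuclideanSpace ℝ (Fin 3)} {ξ : ℝ → EuclideanSpace ℝ (Fin 3)} {γ T : ℝ}

/-! ### Uniform bounds on a time window strictly before the collapse time -/

/-- **Window bounds for the wandering similarity frame.**  For `τ₀ < T`, `0 < γ ≤ 1`, `ξ` and `c` continuous, on the window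
`|τ − τ₀| < (T − τ₀)/2`: `T − τ ≥ δ := (T−τ₀)/2 > 0`, `(T−τ)^γ ≥ δ^γ`, `(T−τ)^{γ−1} ≤ δ^{γ−1}`, `‖ξ τ‖ ≤ Mξ`, `‖c τ‖ ≤ Mc`, and a point `Y` with
`‖ξ(τ) + (T−τ)^γ Y‖ ≤ R₀` satisfies `‖Y‖ ≤ (R₀ + Mξ)/δ^γ`. [folklore] -/
theorem wandering_window_bounds (hγ : 0 < γ) (hγ1 : γ ≤ 1) {τ₀ : ℝ} (hτ₀ : τ₀ < T) (hξ : Continuous ξ)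
    {c : ℝ → EuclideanSpace ℝ (Fin 3)} (hc : Continuous c) (R₀ : ℝ) :
    ∃ δ Mξ Mc : ℝ, 0 < δ ∧ 0 ≤ Mξ ∧ 0 ≤ Mc ∧ ball τ₀ δ ⊆ Iio T ∧
      (∀ τ ∈ ball τ₀ δ, δ ≤ T - τ ∧ δ ^ γ ≤ (T - τ) ^ γ ∧ (T - τ) ^ (γ - 1) ≤ δ ^ (γ - 1) ∧ ‖ξ τ‖ ≤ Mξ ∧ ‖c τ‖ ≤ Mc) ∧
      ∀ τ ∈ ball τ₀ δ, ∀ Y : EuclideanSpace ℝ (Fin 3), ‖ξ τ + (T - τ) ^ γ • Y‖ ≤ R₀ → ‖Y‖ ≤ (R₀ + Mξ) / δ ^ γ := by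
  set δ : ℝ := (T - τ₀) / 2 with hδ
  have hδ0 : 0 < δ := by rw [hδ]; linarith
  obtain ⟨Mξ, hMξ⟩ := (isCompact_Icc (a := τ₀ - δ) (b := τ₀ + δ)).exists_bound_of_continuousOn hξ.continuousOn
  obtain ⟨Mc, hMc⟩ := (isCompact_Icc (a := τ₀ - δ) (b := τ₀ + δ)).exists_bound_of_continuousOn hc.continuousOn
  have hI : ∀ τ ∈ ball τ₀ δ, τ ∈ Icc (τ₀ - δ) (τ₀ + δ) := fun τ hτ => by
    have h := mem_ball_iff_norm.1 hτ
    rw [Real.norm_eq_abs, abs_lt] at h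
    exact ⟨by linarith, by linarith⟩
  have hMξ0 : 0 ≤ Mξ := (norm_nonneg _).trans (hMξ τ₀ ⟨by linarith, by linarith⟩)
  have hMc0 : 0 ≤ Mc := (norm_nonneg _).trans (hMc τ₀ ⟨by linarith, by linarith⟩)
  have hwin : ∀ τ ∈ ball τ₀ δ, δ ≤ T - τ := fun τ hτ => by
    have h := mem_ball_iff_norm.1 hτ
    rw [Real.norm_eq_abs, abs_lt] at h
    rw [hδ] at h ⊢; linarith
  refine ⟨δ, Mξ, Mc, hδ0, hMξ0, hMc0, fun τ hτ => ?_, fun τ hτ => ⟨hwin τ hτ, ?_, ?_, hMξ τ (hI τ hτ), hMc τ (hI τ hτ)⟩,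
    fun τ hτ Y hY => ?_⟩
  · rw [mem_Iio]; linarith [hwin τ hτ]
  · exact Real.rpow_le_rpow hδ0.le (hwin τ hτ) hγ.le
  · exact Real.rpow_le_rpow_of_nonpos hδ0 (hwin τ hτ) (by linarith)
  · have hs : δ ^ γ ≤ (T - τ) ^ γ := Real.rpow_le_rpow hδ0.le (hwin τ hτ) hγ.le
    have hsp : 0 < δ ^ γ := Real.rpow_pos_of_pos hδ0 _
    rw [le_div_iff₀ hsp]
    have h1 : ‖(T - τ) ^ γ • Y‖ ≤ ‖ξ τ + (T - τ) ^ γ • Y‖ + ‖ξ τ‖ := by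
      have := norm_sub_le (ξ τ + (T - τ) ^ γ • Y) (ξ τ)
      rwa [add_sub_cancel_left] at this
    rw [norm_smul, Real.norm_of_nonneg (Real.rpow_nonneg (by linarith [hwin τ hτ]) _)] at h1
    calc ‖Y‖ * δ ^ γ ≤ ‖Y‖ * (T - τ) ^ γ := mul_le_mul_of_nonneg_left hs (norm_nonneg _)
      _ = (T - τ) ^ γ * ‖Y‖ := mul_comm _ _
      _ ≤ R₀ + Mξ := by linarith [hMξ τ (hI τ hτ)]

/-! ### Differentiability of the wandering pairing -/

/-- The path of a frame point: `τ ↦ ξ(τ) + (T−τ)^γ Y` has derivative `ξ'(τ) − γ(T−τ)^{γ−1} Y` at `τ < T`. [folklore] -/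
theorem hasDerivAt_wanderingPoint (hξ : ContDiff ℝ 1 ξ) {τ : ℝ} (hτ : τ < T) (Y : EuclideanSpace ℝ (Fin 3)) :
    HasDerivAt (fun t : ℝ => ξ t + (T - t) ^ γ • Y) (deriv ξ τ + (-(γ * (T - τ) ^ (γ - 1))) • Y) τ := by
  have h1 : HasDerivAt ξ (deriv ξ τ) τ := ((hξ.differentiable (by simp)) τ).hasDerivAt
  have h2 : HasDerivAt (fun t : ℝ => (T - t) ^ γ) (-(γ * (T - τ) ^ (γ - 1))) τ := by
    have h := ((hasDerivAt_id τ).const_sub T).rpow_const (p := γ) (Or.inl (by simp only [id]; linarith))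
    simp only [id] at h
    convert h using 1; ring
  exact h1.add (h2.smul_const Y)

/-- **Dominated differentiation of the wandering pairing.**  For `V ∈ L¹_loc`, a test field `Φ`, `ξ ∈ C¹`, `0 < γ ≤ 1` and `τ₀ < T`:
`τ ↦ ∫ ⟪V(Y), Φ(ξ(τ) + (T−τ)^γ Y)⟫ dY` has derivative `∫ ⟪V(Y), DΦ(ξ(τ₀) + (T−τ₀)^γ Y)(ξ'(τ₀) − γ(T−τ₀)^{γ−1} Y)⟫ dY` at `τ₀`. [folklore] -/
theorem hasDerivAt_wanderingPairing (hV : LocallyIntegrable V volume) (hξ : ContDiff ℝ 1 ξ) (hγ : 0 < γ) (hγ1 : γ ≤ 1)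
    {Φ : EuclideanSpace ℝ (Fin 3) → EuclideanSpace ℝ (Fin 3)} (hΦ : IsTestFunctionOn (⊤ : Opens (EuclideanSpace ℝ (Fin 3))) Φ)
    {τ₀ : ℝ} (hτ₀ : τ₀ < T) :
    HasDerivAt (fun τ : ℝ => ∫ Y, ⟪V Y, Φ (ξ τ + (T - τ) ^ γ • Y)⟫)
      (∫ Y, ⟪V Y, (fderiv ℝ Φ (ξ τ₀ + (T - τ₀) ^ γ • Y)) (deriv ξ τ₀ + (-(γ * (T - τ₀) ^ (γ - 1))) • Y)⟫) τ₀ := by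
  have hΦc : Continuous Φ := hΦ.contDiff.continuous
  have hΦd : Differentiable ℝ Φ := hΦ.contDiff.differentiable (by simp)
  have hDΦc : Continuous (fderiv ℝ Φ) := hΦ.contDiff.continuous_fderiv (by simp)
  have hDΦs : HasCompactSupport (fderiv ℝ Φ) := hΦ.hasCompactSupport.fderiv (𝕜 := ℝ)
  have hξc : Continuous ξ := hξ.continuous
  have hξ'c : Continuous (deriv ξ) := hξ.continuous_deriv le_rfl
  obtain ⟨M₁, hM₁⟩ := hDΦc.bounded_above_of_compact_support hDΦs
  have hM₁0 : 0 ≤ M₁ := (norm_nonneg _).trans (hM₁ 0)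
  obtain ⟨R₀, hR₀⟩ := (hΦ.hasCompactSupport.isCompact.isBounded).subset_closedBall (0 : EuclideanSpace ℝ (Fin 3))
  obtain ⟨δ, Mξ, Mξ', hδ, hMξ0, hMξ'0, hballT, hwin, hsupp⟩ := wandering_window_bounds hγ hγ1 hτ₀ hξc hξ'c R₀
  set RY : ℝ := (R₀ + Mξ) / δ ^ γ with hRY
  have hδγ : 0 < δ ^ γ := Real.rpow_pos_of_pos hδ _
  set K : Set (EuclideanSpace ℝ (Fin 3)) := closedBall 0 RY with hK
  have hKc : IsCompact K := isCompact_closedBall _ _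
  -- the integrands
  set F : ℝ → EuclideanSpace ℝ (Fin 3) → ℝ := fun t Y => ⟪V Y, Φ (ξ t + (T - t) ^ γ • Y)⟫ with hF
  set F' : ℝ → EuclideanSpace ℝ (Fin 3) → ℝ := fun t Y =>
    ⟪V Y, (fderiv ℝ Φ (ξ t + (T - t) ^ γ • Y)) (deriv ξ t + (-(γ * (T - t) ^ (γ - 1))) • Y)⟫ with hF'
  set Cb : ℝ := M₁ * (Mξ' + γ * δ ^ (γ - 1) * RY) with hCb
  set bound : EuclideanSpace ℝ (Fin 3) → ℝ := K.indicator fun Y => Cb * ‖V Y‖ with hbound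
  have hbound_int : Integrable bound volume := by
    rw [hbound, integrable_indicator_iff hKc.measurableSet]
    exact ((hV.integrableOn_isCompact hKc).norm.const_mul Cb)
  have hpc : ∀ t, Continuous fun Y : EuclideanSpace ℝ (Fin 3) => ξ t + (T - t) ^ γ • Y := fun t =>
    continuous_const.add (continuous_const_smul _)
  have hF_meas : ∀ t, AEStronglyMeasurable (F t) volume := fun t =>
    hV.aestronglyMeasurable.inner (hΦc.comp (hpc t)).aestronglyMeasurable
  -- the integrand at `τ₀` is integrable (compact support in `Y`)
  have hF_int : Integrable (F τ₀) volume := by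
    have hτ₀b : τ₀ ∈ ball τ₀ δ := mem_ball_self hδ
    have hsuppF : support (F τ₀) ⊆ K := by
      intro Y hY
      rw [mem_support] at hY
      have hne : Φ (ξ τ₀ + (T - τ₀) ^ γ • Y) ≠ 0 := fun h => hY (by simp only [hF, h, inner_zero_right])
      have h1 : ‖ξ τ₀ + (T - τ₀) ^ γ • Y‖ ≤ R₀ := mem_closedBall_zero_iff.1 (hR₀ (subset_tsupport _ (mem_support.2 hne)))
      exact mem_closedBall_zero_iff.2 (hsupp τ₀ hτ₀b Y h1)
    obtain ⟨CΦ, hCΦ⟩ := hΦc.bounded_above_of_compact_support hΦ.hasCompactSupport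
    have hg : Integrable (fun Y => CΦ * ‖K.indicator (fun Y => ‖V Y‖) Y‖) volume :=
      ((integrable_indicator_iff hKc.measurableSet).2 (hV.integrableOn_isCompact hKc).norm).norm.const_mul CΦ
    refine hg.mono' (hF_meas τ₀) (Eventually.of_forall fun Y => ?_)
    by_cases hY : Y ∈ K
    · rw [indicator_of_mem hY, Real.norm_of_nonneg (norm_nonneg _), hF]
      calc ‖⟪V Y, Φ (ξ τ₀ + (T - τ₀) ^ γ • Y)⟫‖ ≤ ‖V Y‖ * ‖Φ (ξ τ₀ + (T - τ₀) ^ γ • Y)‖ := norm_inner_le_norm _ _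
        _ ≤ ‖V Y‖ * CΦ := by gcongr; exact hCΦ _
        _ = CΦ * ‖V Y‖ := mul_comm _ _
    · have h0 : F τ₀ Y = 0 := by by_contra h; exact hY (hsuppF (mem_support.2 h))
      rw [h0, norm_zero, indicator_of_notMem hY, norm_zero, mul_zero]
  have hF'_meas : AEStronglyMeasurable (F' τ₀) volume := by
    have h1 : Continuous fun Y : EuclideanSpace ℝ (Fin 3) =>
        (fderiv ℝ Φ (ξ τ₀ + (T - τ₀) ^ γ • Y)) (deriv ξ τ₀ + (-(γ * (T - τ₀) ^ (γ - 1))) • Y) :=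
      (hDΦc.comp (hpc τ₀)).clm_apply (continuous_const.add (continuous_const_smul _))
    exact hV.aestronglyMeasurable.inner h1.aestronglyMeasurable
  -- the bound on the window
  have h_bound : ∀ᵐ Y ∂(volume : Measure (EuclideanSpace ℝ (Fin 3))), ∀ t ∈ ball τ₀ δ, ‖F' t Y‖ ≤ bound Y := by
    refine ae_of_all _ fun Y t ht => ?_
    obtain ⟨hTt, hsγ, hsγ1, hξt, hξ't⟩ := hwin t ht
    by_cases hY : Y ∈ K
    · rw [hbound, indicator_of_mem hY, hF']
      have hYn : ‖Y‖ ≤ RY := mem_closedBall_zero_iff.1 hY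
      have hvec : ‖deriv ξ t + (-(γ * (T - t) ^ (γ - 1))) • Y‖ ≤ Mξ' + γ * δ ^ (γ - 1) * RY := by
        refine (norm_add_le _ _).trans (add_le_add hξ't ?_)
        rw [norm_smul, norm_neg, Real.norm_of_nonneg (mul_nonneg hγ.le (Real.rpow_nonneg (by linarith) _))]
        have : γ * (T - t) ^ (γ - 1) ≤ γ * δ ^ (γ - 1) := mul_le_mul_of_nonneg_left hsγ1 hγ.le
        exact mul_le_mul this hYn (norm_nonneg _) (mul_nonneg hγ.le (Real.rpow_nonneg hδ.le _))
      calc ‖⟪V Y, (fderiv ℝ Φ (ξ t + (T - t) ^ γ • Y)) (deriv ξ t + (-(γ * (T - t) ^ (γ - 1))) • Y)⟫‖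
          ≤ ‖V Y‖ * ‖(fderiv ℝ Φ (ξ t + (T - t) ^ γ • Y)) (deriv ξ t + (-(γ * (T - t) ^ (γ - 1))) • Y)‖ :=
            norm_inner_le_norm _ _
        _ ≤ ‖V Y‖ * (M₁ * (Mξ' + γ * δ ^ (γ - 1) * RY)) := by
            gcongr
            exact (ContinuousLinearMap.le_opNorm _ _).trans
              (mul_le_mul (hM₁ _) hvec (norm_nonneg _) hM₁0)
        _ = Cb * ‖V Y‖ := by rw [hCb]; ring
    · -- off `K` the frame point misses the support of `Φ`
      have hzt : ξ t + (T - t) ^ γ • Y ∉ tsupport Φ := by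
        intro hmem
        have h1 : ‖ξ t + (T - t) ^ γ • Y‖ ≤ R₀ := mem_closedBall_zero_iff.1 (hR₀ hmem)
        exact hY (mem_closedBall_zero_iff.2 (hsupp t ht Y h1))
      have hD0 : fderiv ℝ Φ (ξ t + (T - t) ^ γ • Y) = 0 := by
        by_contra hne
        exact hzt (support_fderiv_subset ℝ (mem_support.2 hne))
      rw [hbound, indicator_of_notMem hY]
      simp only [hF', hD0, zero_apply, inner_zero_right, norm_zero, le_refl]
  -- pointwise derivative
  have h_diff : ∀ᵐ Y ∂(volume : Measure (EuclideanSpace ℝ (Fin 3))), ∀ t ∈ ball τ₀ δ,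
      HasDerivAt (fun t : ℝ => F t Y) (F' t Y) t := by
    refine ae_of_all _ fun Y t ht => ?_
    have htT : t < T := hballT ht
    have hg : HasDerivAt (fun t : ℝ => Φ (ξ t + (T - t) ^ γ • Y))
        ((fderiv ℝ Φ (ξ t + (T - t) ^ γ • Y)) (deriv ξ t + (-(γ * (T - t) ^ (γ - 1))) • Y)) t :=
      (hΦd _).hasFDerivAt.comp_hasDerivAt t (hasDerivAt_wanderingPoint hξ htT Y)
    have h := (hasDerivAt_const t (V Y)).inner ℝ hg
    simpa [hF, hF'] using h
  exact (hasDerivAt_integral_of_dominated_loc_of_deriv_le (ball_mem_nhds τ₀ hδ)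
    (Eventually.of_forall hF_meas) hF_int hF'_meas h_bound hbound_int h_diff).2

/-! ### Continuity of the wandering pairings on `(−∞, T)` -/

/-- **Continuity of the linear wandering pairing** `τ ↦ ∫ ⟪V(Y), Ψ(ξ(τ) + (T−τ)^γ Y)(c(τ) + d(τ) • Y)⟫ dY` on `(−∞, T)` (`V ∈ L¹_loc`,
`Ψ` a continuous compactly supported operator field, `ξ, c : ℝ → ℝ³` continuous, `d : ℝ → ℝ` continuous on `(−∞,T)`, `0 < γ ≤ 1`). [folklore] -/
theorem continuousOn_wanderingPairing_clm (hV : LocallyIntegrable V volume) (hξ : Continuous ξ) (hγ : 0 < γ) (hγ1 : γ ≤ 1)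
    {Ψ : EuclideanSpace ℝ (Fin 3) → EuclideanSpace ℝ (Fin 3) →L[ℝ] EuclideanSpace ℝ (Fin 3)} (hΨ : Continuous Ψ)
    (hΨc : HasCompactSupport Ψ) {c : ℝ → EuclideanSpace ℝ (Fin 3)} (hc : Continuous c) {d : ℝ → ℝ} (hd : ContinuousOn d (Iio T)) :
    ContinuousOn (fun τ : ℝ => ∫ Y, ⟪V Y, Ψ (ξ τ + (T - τ) ^ γ • Y) (c τ + d τ • Y)⟫) (Iio T) := by
  intro τ₀ hτ₀
  have hτ₀T : τ₀ < T := hτ₀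
  refine ContinuousAt.continuousWithinAt ?_
  obtain ⟨M₁, hM₁⟩ := hΨ.bounded_above_of_compact_support hΨc
  have hM₁0 : 0 ≤ M₁ := (norm_nonneg _).trans (hM₁ 0)
  obtain ⟨R₀, hR₀⟩ := hΨc.isCompact.isBounded.subset_closedBall (0 : EuclideanSpace ℝ (Fin 3))
  obtain ⟨δ, Mξ, Mc, hδ, hMξ0, hMc0, hballT, hwin, hsupp⟩ := wandering_window_bounds hγ hγ1 hτ₀T hξ hc R₀
  -- a bound for `d` on the closed half-window
  have hhalf : Icc (τ₀ - δ / 2) (τ₀ + δ / 2) ⊆ ball τ₀ δ := fun t ht => by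
    rw [mem_ball, Real.dist_eq, abs_lt]; constructor <;> linarith [ht.1, ht.2]
  obtain ⟨Md, hMd⟩ := (isCompact_Icc (a := τ₀ - δ / 2) (b := τ₀ + δ / 2)).exists_bound_of_continuousOn
    (hd.mono fun t ht => hballT (hhalf ht))
  have hMd0 : 0 ≤ Md := (norm_nonneg _).trans (hMd τ₀ ⟨by linarith, by linarith⟩)
  have hball2 : ∀ t ∈ ball τ₀ (δ / 2), t ∈ Icc (τ₀ - δ / 2) (τ₀ + δ / 2) := fun t ht => by
    have h := mem_ball_iff_norm.1 ht
    rw [Real.norm_eq_abs, abs_lt] at h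
    exact ⟨by linarith, by linarith⟩
  set RY : ℝ := (R₀ + Mξ) / δ ^ γ with hRY
  set K : Set (EuclideanSpace ℝ (Fin 3)) := closedBall 0 RY with hK
  have hKc : IsCompact K := isCompact_closedBall _ _
  set Cb : ℝ := M₁ * (Mc + Md * |RY|) with hCb
  set bound : EuclideanSpace ℝ (Fin 3) → ℝ := K.indicator fun Y => Cb * ‖V Y‖ with hbound
  have hbound_int : Integrable bound volume := by
    rw [hbound, integrable_indicator_iff hKc.measurableSet]
    exact ((hV.integrableOn_isCompact hKc).norm.const_mul Cb)
  have hpc : ∀ t, Continuous fun Y : EuclideanSpace ℝ (Fin 3) => ξ t + (T - t) ^ γ • Y := fun t =>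
    continuous_const.add (continuous_const_smul _)
  have hF_meas : ∀ t : ℝ, AEStronglyMeasurable (fun Y => ⟪V Y, Ψ (ξ t + (T - t) ^ γ • Y) (c t + d t • Y)⟫) volume := fun t =>
    hV.aestronglyMeasurable.inner
      (((hΨ.comp (hpc t)).clm_apply (continuous_const.add (continuous_const_smul _))).aestronglyMeasurable)
  refine continuousAt_of_dominated (Eventually.of_forall hF_meas) ?_ hbound_int ?_
  · filter_upwards [ball_mem_nhds τ₀ (half_pos hδ)] with t ht
    have ht' : t ∈ ball τ₀ δ := hhalf (hball2 t ht)
    obtain ⟨hTt, hsγ, hsγ1, hξt, hct⟩ := hwin t ht'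
    refine ae_of_all _ fun Y => ?_
    by_cases hY : Y ∈ K
    · rw [hbound, indicator_of_mem hY]
      have hYn : ‖Y‖ ≤ |RY| := (mem_closedBall_zero_iff.1 hY).trans (le_abs_self _)
      have hvec : ‖c t + d t • Y‖ ≤ Mc + Md * |RY| := by
        refine (norm_add_le _ _).trans (add_le_add hct ?_)
        rw [norm_smul]
        exact mul_le_mul (hMd t (hball2 t ht)) hYn (norm_nonneg _) hMd0
      calc ‖⟪V Y, Ψ (ξ t + (T - t) ^ γ • Y) (c t + d t • Y)⟫‖
          ≤ ‖V Y‖ * ‖Ψ (ξ t + (T - t) ^ γ • Y) (c t + d t • Y)‖ := norm_inner_le_norm _ _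
        _ ≤ ‖V Y‖ * (M₁ * (Mc + Md * |RY|)) := by
            gcongr
            exact (ContinuousLinearMap.le_opNorm _ _).trans (mul_le_mul (hM₁ _) hvec (norm_nonneg _) hM₁0)
        _ = Cb * ‖V Y‖ := by rw [hCb]; ring
    · have hΨ0 : Ψ (ξ t + (T - t) ^ γ • Y) = 0 := by
        by_contra hne
        have h1 : ‖ξ t + (T - t) ^ γ • Y‖ ≤ R₀ := mem_closedBall_zero_iff.1 (hR₀ (subset_tsupport _ (mem_support.2 hne)))
        exact hY (mem_closedBall_zero_iff.2 (hsupp t ht' Y h1))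
      rw [hbound, indicator_of_notMem hY, hΨ0]
      simp
  · refine ae_of_all _ fun Y => ?_
    have h1 : ContinuousAt (fun t : ℝ => Ψ (ξ t + (T - t) ^ γ • Y)) τ₀ := by
      refine (hΨ.continuousAt).comp ?_
      exact hξ.continuousAt.add (((continuousAt_const.sub continuousAt_id).rpow_const
        (Or.inl (sub_pos.2 hτ₀T).ne')).smul continuousAt_const)
    have h2 : ContinuousAt (fun t : ℝ => c t + d t • Y) τ₀ :=
      hc.continuousAt.add ((hd.continuousAt (isOpen_Iio.mem_nhds hτ₀T)).smul continuousAt_const)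
    exact continuousAt_const.inner (h1.clm_apply h2)

/-- **Continuity of the quadratic wandering pairing** `τ ↦ ∫ ⟪V(Y), Ψ(ξ(τ) + (T−τ)^γ Y) V(Y)⟫ dY` on `(−∞, T)` (`|V|² ∈ L¹_loc`). [folklore] -/
theorem continuousOn_wanderingPairing_clm_self (hVm : AEStronglyMeasurable V volume)
    (hV2 : LocallyIntegrable (fun z => ‖V z‖ ^ 2) volume) (hξ : Continuous ξ) (hγ : 0 < γ) (hγ1 : γ ≤ 1)
    {Ψ : EuclideanSpace ℝ (Fin 3) → EuclideanSpace ℝ (Fin 3) →L[ℝ] EuclideanSpace ℝ (Fin 3)} (hΨ : Continuous Ψ)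
    (hΨc : HasCompactSupport Ψ) :
    ContinuousOn (fun τ : ℝ => ∫ Y, ⟪V Y, Ψ (ξ τ + (T - τ) ^ γ • Y) (V Y)⟫) (Iio T) := by
  intro τ₀ hτ₀
  have hτ₀T : τ₀ < T := hτ₀
  refine ContinuousAt.continuousWithinAt ?_
  obtain ⟨M₁, hM₁⟩ := hΨ.bounded_above_of_compact_support hΨc
  have hM₁0 : 0 ≤ M₁ := (norm_nonneg _).trans (hM₁ 0)
  obtain ⟨R₀, hR₀⟩ := hΨc.isCompact.isBounded.subset_closedBall (0 : EuclideanSpace ℝ (Fin 3))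
  obtain ⟨δ, Mξ, -, hδ, hMξ0, -, hballT, hwin, hsupp⟩ :=
    wandering_window_bounds hγ hγ1 hτ₀T hξ (continuous_const (y := (0 : EuclideanSpace ℝ (Fin 3)))) R₀
  set RY : ℝ := (R₀ + Mξ) / δ ^ γ with hRY
  set K : Set (EuclideanSpace ℝ (Fin 3)) := closedBall 0 RY with hK
  have hKc : IsCompact K := isCompact_closedBall _ _
  set bound : EuclideanSpace ℝ (Fin 3) → ℝ := K.indicator fun Y => M₁ * ‖V Y‖ ^ 2 with hbound
  have hbound_int : Integrable bound volume := by
    rw [hbound, integrable_indicator_iff hKc.measurableSet]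
    exact ((hV2.integrableOn_isCompact hKc).const_mul M₁)
  have hpc : ∀ t, Continuous fun Y : EuclideanSpace ℝ (Fin 3) => ξ t + (T - t) ^ γ • Y := fun t =>
    continuous_const.add (continuous_const_smul _)
  have hF_meas : ∀ t : ℝ, AEStronglyMeasurable (fun Y => ⟪V Y, Ψ (ξ t + (T - t) ^ γ • Y) (V Y)⟫) volume := fun t =>
    hVm.inner ((isBoundedBilinearMap_apply (𝕜 := ℝ) (E := EuclideanSpace ℝ (Fin 3))
      (F := EuclideanSpace ℝ (Fin 3))).continuous.comp_aestronglyMeasurable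
        ((hΨ.comp (hpc t)).aestronglyMeasurable.prodMk hVm))
  refine continuousAt_of_dominated (Eventually.of_forall hF_meas) ?_ hbound_int ?_
  · filter_upwards [ball_mem_nhds τ₀ hδ] with t ht
    refine ae_of_all _ fun Y => ?_
    by_cases hY : Y ∈ K
    · rw [hbound, indicator_of_mem hY]
      calc ‖⟪V Y, Ψ (ξ t + (T - t) ^ γ • Y) (V Y)⟫‖ ≤ ‖V Y‖ * ‖Ψ (ξ t + (T - t) ^ γ • Y) (V Y)‖ := norm_inner_le_norm _ _
        _ ≤ ‖V Y‖ * (M₁ * ‖V Y‖) := by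
            gcongr
            exact (ContinuousLinearMap.le_opNorm _ _).trans (mul_le_mul_of_nonneg_right (hM₁ _) (norm_nonneg _))
        _ = M₁ * ‖V Y‖ ^ 2 := by ring
    · have hΨ0 : Ψ (ξ t + (T - t) ^ γ • Y) = 0 := by
        by_contra hne
        have h1 : ‖ξ t + (T - t) ^ γ • Y‖ ≤ R₀ := mem_closedBall_zero_iff.1 (hR₀ (subset_tsupport _ (mem_support.2 hne)))
        exact hY (mem_closedBall_zero_iff.2 (hsupp t ht Y h1))
      rw [hbound, indicator_of_notMem hY, hΨ0]
      simp
  · refine ae_of_all _ fun Y => ?_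
    have h1 : ContinuousAt (fun t : ℝ => Ψ (ξ t + (T - t) ^ γ • Y)) τ₀ := by
      refine (hΨ.continuousAt).comp ?_
      exact hξ.continuousAt.add (((continuousAt_const.sub continuousAt_id).rpow_const
        (Or.inl (sub_pos.2 hτ₀T).ne')).smul continuousAt_const)
    exact continuousAt_const.inner (h1.clm_apply continuousAt_const)

end GalileanFrames

end Summit.NavierStokesRegularity.NavierStokesRegularity.Theorems.PowerGaugeEulerLiouville
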